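import Literature.AlgebraicGeometry.Frobenioids.BirationalizationBiratData
import Literature.AlgebraicGeometry.Frobenioids.BirationalizationProp44General
import Literature.AlgebraicGeometry.Frobenioids.BiratLocalization
import Literature.AlgebraicGeometry.Frobenioids.PreFrobenioidDataToFunctor
import Literature.AlgebraicGeometry.Frobenioids.PerfectionFunctoriality
import Literature.AlgebraicGeometry.Frobenioids.PerfectionEquivalence
import Literature.AlgebraicGeometry.Frobenioids.PerfectionFrobeniusArrows
import Literature.AlgebraicGeometry.Frobenioids.PerfectionIsos
import Literature.AlgebraicGeometry.Frobenioids.PreFrobenioidEquivalence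
import HarnessLib

/-!
# [FrdI] Prop. 5.5 (ii), second clause: the comparison functor `(C^pf)^birat → (C^birat)^pf`

[cite: MochizukiFrdI2008, Prop. 5.5 (ii) p.104]

Mochizuki, *The geometry of Frobenioids I*, Prop. 5.5 (ii) (p. 104; proof p. 105 ll. 1–8): "a natural
equivalence of categories `(C^pf)^birat ≅ (C^birat)^pf` compatible with the natural functors to
elementary Frobenioids", obtained from "natural bijections between the respective sets of morphisms"
(Def. 3.1 (iii), Prop. 3.2 (ii)).  Against THE perfection `PreFrobenioid.Perfection hF`
(abc-iut-L1-d9) and THE birationalization `PreFrobenioid.Birat F hF hsq` (abc-iut-L6-t8) this file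
constructs the comparison functor: (1) by Prop. 4.4 (iv) (abc-iut-w4-d020,
`BirationalizationProp44General.lean`: an arrow of Frobenius type of `C` maps to an arrow of Frobenius
type of `C^birat`, structure `C^birat → F_{0_D}`) and Prop. 4.4 (i) (same Frobenius degree),
`C → C^birat` is Frobenius-compatible (`isFrobeniusCompatible_toBirat`); (2) hence, by the
functoriality of the perfection (Thm. 3.4 (iii), `Perfection.map`), a functor
`P : C^pf → (C^birat)^pf`, `(A, n) ↦ (A^birat, n)` (`PerfectionBirat.perfMap`); (3) `P` inverts the
co-angular pre-steps of `C^pf` (`PerfectionBirat.perfMap_inverts`, via Def. 1.3 (v)(b) and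
Prop. 3.2 (ii)); (4) by the universal property of `C^pf → (C^pf)^birat` (Prop. 4.4 (i), `Birat.lift`)
`P` descends to THE comparison functor (`PerfectionBirat.comparison`), the identity on objects, lying
over `D` on the nose (`PerfectionBirat.comparison_comp_base`).  That it is an equivalence (the hom-set
bijections) is `PerfectionBiratCommuteEquiv.lean`.
-/

namespace Literature.AlgebraicGeometry.Frobenioids

namespace PreFrobenioid

open CategoryTheory Opposite

universe w v v' u u'

variable {D : Type u} [Category.{v} D] {Φ : Dᵒᵖ ⥤ CommMonCat.{w}}
  {C : Type u'} [Category.{v'} C] {F : C ⥤ ElemFrobenioid Φ}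
  {hF : IsFrobenioid F} {hsq : HasBiratSquares F}

/-! ### Step 1: `C → C^birat` is Frobenius-compatible (Prop. 4.4 (iv)) -/

/-- **`C → C^birat` is Frobenius-compatible** (for the Frobenioid structure `C^birat → F_{0_D}` in its
functor form): it carries arrows of Frobenius type to arrows of Frobenius type (Prop. 4.4 (iv)) of the
same Frobenius degree (Prop. 4.4 (i)) — the hypothesis under which the perfection is functorial
(Thm. 3.4 (iii)). [cite: MochizukiFrdI2008, Prop. 4.4 (iv) p.83] -/
theorem isFrobeniusCompatible_toBirat (hF : IsFrobenioid F) (hsq : HasBiratSquares F) :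
    IsFrobeniusCompatible F (biratOps hF hsq).toFunctor (toBirat F hF hsq) where
  isFrobeniusType_map _ _ φ hφ :=
    (PreFrobenioidData.isFrobeniusType_toFunctor_iff _ _).mpr
      (toBirat_preservesMor_isFrobeniusType φ
        ⟨(PreFrobenioidData.ofFunctor_isCoAngular F φ).mpr hφ.1.1, hφ.2⟩)
  degFr_map _ _ f _ :=
    (PreFrobenioidData.ofFunctor_toFunctor_degFr (biratOps hF hsq) ((toBirat F hF hsq).map f)).trans
      (biratOps_degFr_toBirat f)

/-! ### Step 2: the functor `P : C^pf → (C^birat)^pf` -/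

namespace PerfectionBirat

variable (hF hsq) in
/-- The functor `P = (C → C^birat)^pf : C^pf → (C^birat)^pf`, `(A, n) ↦ (A^birat, n)` (Thm. 3.4 (iii)
functoriality applied to the Frobenius-compatible functor `C → C^birat`; `hBi` is the Frobenioid
structure of `C^birat`, Prop. 4.4 (ii)). [cite: MochizukiFrdI2008, Prop. 5.5 (ii) p.104] -/
noncomputable def perfMap (hBi : IsFrobenioid (biratOps hF hsq).toFunctor) :
    Perfection hF ⥤ Perfection hBi :=
  Perfection.map (hF₁ := hF) (hF₂ := hBi) (isFrobeniusCompatible_toBirat hF hsq)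

variable {hBi : IsFrobenioid (biratOps hF hsq).toFunctor}

/-- `P` on the class of a representative. [cite: MochizukiFrdI2008, Prop. 5.5 (ii) p.104] -/
theorem perfMap_map_mk {X Y : Perfection hF} (r : Perfection.Rep X Y) :
    (perfMap hF hsq hBi).map (Perfection.Hom.mk r) =
      Perfection.Hom.mk (Perfection.repMap (hF₁ := hF) (hF₂ := hBi)
        (isFrobeniusCompatible_toBirat hF hsq) r) :=
  rfl

/-! ### Step 3: `P` inverts the co-angular pre-steps of `C^pf` -/

/-- **`P` inverts the co-angular pre-steps of `C^pf`.**  A co-angular pre-step `[s]` of `C^pf`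
(`s : A^{(a)} → B^{(b)}` a pre-step of `C`, Prop. 3.2 (ii)) factors by Def. 1.3 (v)(b) as
`[s] = [b₁] ≫ [b₂]`, `b₁` a co-angular pre-step of `C` (so `P[b₁]`, a conjugate of `b₁^birat`, is
invertible, Prop. 4.4 (iv)) and `[b₂]` an isometric pre-step of `C^pf`, invertible by co-angularity of
`[s]`. [cite: MochizukiFrdI2008, Prop. 5.5 (ii) p.105] -/
theorem perfMap_inverts (hBi : IsFrobenioid (biratOps hF hsq).toFunctor) :
    (coAngularPreSteps (Perfection.ops hF).toFunctor).IsInvertedBy (perfMap hF hsq hBi) := by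
  intro X Y f hf
  have hco : (Perfection.ops hF).IsCoAngular f :=
    (PreFrobenioidData.ofFunctor_isCoAngular (Perfection.ops hF).toFunctor f).mpr hf.1
  have hpre : (Perfection.ops hF).IsPreStep f :=
    (PreFrobenioidData.isPreStep_toFunctor_iff _ f).mp hf.2
  obtain ⟨s, rfl⟩ := Perfection.Hom.mk_surjective f
  have hs : IsPreStep F s.hom := (Perfection.isPreStep_mk_iff s).mp hpre
  obtain ⟨B₁, b₁, b₂, hfac, hb₁, hb₂iso, hb₂pre⟩ := hF.v_b_exists s.hom hs
  haveI := Perfection.isIso_frob_one (hF := hF) B₁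
  -- the intermediate object `(B₁, n·a)` and the two representatives
  let Z : Perfection hF := ⟨B₁, X.idx * s.L.a⟩
  let T : Perfection.Level₃ X Z Y :=
    ⟨s.L.a, 1, s.L.b, (mul_one _).symm, by rw [mul_one]; exact s.L.eq⟩
  let r₁ : Perfection.Rep X Z := ⟨T.fst, b₁ ≫ frob hF B₁ 1⟩
  let r₂ : Perfection.Rep Z Y := ⟨T.snd, inv (frob hF B₁ 1) ≫ b₂⟩
  have hcomp : (Perfection.Hom.mk r₁ ≫ Perfection.Hom.mk r₂ : X ⟶ Y) = Perfection.Hom.mk s := by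
    rw [Perfection.mk_comp_mk, ← Perfection.mk_compAt T r₁ r₂ (Perfection.Level.le_rfl _)
      (Perfection.Level.le_rfl _)]
    simp only [Perfection.compAt, Perfection.Level.lift_rfl, r₁, r₂, Category.assoc,
      IsIso.hom_inv_id_assoc]
    rw [hfac]
  -- `[r₂]` is an isometric pre-step of `C^pf`, hence (co-angularity of `[s]`) an isomorphism
  have hr₂ : (Perfection.ops hF).IsIsometricPreStep (X := Z) (Y := Y) (Perfection.Hom.mk r₂) :=
    (Perfection.isIsometricPreStep_mk_iff r₂).mpr ⟨IsPreStep.comp F (isPreStep_of_isIso F _) hb₂pre,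
      IsIsometry.comp F (isIsometry_of_isIso F hF.isPreFrobenioid _) hb₂iso⟩
  have hlin : (Perfection.ops hF).IsLinear (𝟙 Y) := (Perfection.ops hF).degFr_id Y
  have hbi : (Perfection.ops hF).IsBaseIso (𝟙 Y) ∨
      (Perfection.ops hF).IsBaseIso (X := X) (Y := Z) (Perfection.Hom.mk r₁) := by
    refine Or.inl ?_
    change IsIso ((Perfection.ops hF).base.map (𝟙 Y))
    rw [(Perfection.ops hF).base.map_id]
    infer_instance
  haveI hiso₂ : IsIso (X := Z) (Y := Y) (Perfection.Hom.mk r₂) :=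
    hco (Perfection.Hom.mk r₁) (Perfection.Hom.mk r₂) (𝟙 Y)
      (by rw [Category.comp_id, hcomp]) hlin hr₂ hbi
  -- `P[r₁]` is an isomorphism: its arrow is a conjugate of `(b₁ ≫ frob)^birat`
  haveI := toBirat_inverts hF hsq _ (hb₁.comp_iso (frob hF B₁ 1))
  haveI hiso₁ : IsIso ((perfMap hF hsq hBi).map (Perfection.Hom.mk r₁ : X ⟶ Z)) := by
    rw [perfMap_map_mk]
    refine Perfection.isIso_mk_of_isIso _ ?_
    rw [Perfection.repMap_hom]
    exact IsIso.comp_isIso' inferInstance (IsIso.comp_isIso'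
      (toBirat_inverts hF hsq _ (hb₁.comp_iso (frob hF B₁ 1))) inferInstance)
  rw [← hcomp, Functor.map_comp]
  infer_instance

/-! ### Step 4: the comparison functor `(C^pf)^birat → (C^birat)^pf` -/

variable (hF hsq) in
/-- **THE comparison functor `(C^pf)^birat → (C^birat)^pf`** of [FrdI] Prop. 5.5 (ii): induced on the
birationalization of `C^pf` (universal property, Prop. 4.4 (i)) by `P`, which inverts the co-angular
pre-steps; `(A, n) ↦ (A^birat, n)`, `[(α, φ′)] ↦ P(α)⁻¹ ≫ P(φ′)` (`hPf`, `hBi`: the Frobenioid structures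
of `C^pf`, `C^birat`; `hsq'`: Prop. 1.11 (vii) for `C^pf`). [cite: MochizukiFrdI2008, Prop. 5.5 (ii) p.104] -/
noncomputable def comparison (hPf : IsFrobenioid (Perfection.ops hF).toFunctor)
    (hsq' : HasBiratSquares (Perfection.ops hF).toFunctor)
    (hBi : IsFrobenioid (biratOps hF hsq).toFunctor) :
    Birat (Perfection.ops hF).toFunctor hPf hsq' ⥤ Perfection hBi :=
  Birat.lift hPf hsq' (perfMap hF hsq hBi) (perfMap_inverts hBi)

variable {hPf : IsFrobenioid (Perfection.ops hF).toFunctor}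
  {hsq' : HasBiratSquares (Perfection.ops hF).toFunctor}

/-- `(C^pf → (C^pf)^birat) ⋙ comparison = P`. [cite: MochizukiFrdI2008, Prop. 5.5 (ii) p.104] -/
theorem toBirat_comp_comparison :
    toBirat (Perfection.ops hF).toFunctor hPf hsq' ⋙ comparison hF hsq hPf hsq' hBi =
      perfMap hF hsq hBi :=
  toBirat_comp_lift _ _

/-- The comparison functor on objects: `(A, n) ↦ (A^birat, n)`.
[cite: MochizukiFrdI2008, Prop. 5.5 (ii) p.104] -/
theorem comparison_obj (X : Birat (Perfection.ops hF).toFunctor hPf hsq') :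
    (comparison hF hsq hPf hsq' hBi).obj X = ⟨(toBirat F hF hsq).obj X.out.obj, X.out.idx⟩ :=
  rfl

/-- The comparison functor on a class of fractions: `[(α, φ′)] ↦ P(α)⁻¹ ≫ P(φ′)`.
[cite: MochizukiFrdI2008, Prop. 5.5 (ii) p.104] -/
theorem comparison_map_homMk {X Y : Birat (Perfection.ops hF).toFunctor hPf hsq'}
    (f : BiratFrac (Perfection.ops hF).toFunctor X.out Y.out) :
    (comparison hF hsq hPf hsq' hBi).map (Birat.homMk f) =
      (haveI := perfMap_inverts hBi f.den f.den_mem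
       inv ((perfMap hF hsq hBi).map f.den) ≫ (perfMap hF hsq hBi).map f.num) :=
  rfl

/-! ### Compatibility with the functors to the base category -/

/-- Bookkeeping: if `fA ≫ jA = fA′` and `fB ≫ jB = fB′` then
`M(fA′) ≫ M(jA⁻¹ ≫ ρ ≫ jB) ≫ M(fB′)⁻¹ = M(fA) ≫ M(ρ) ≫ M(fB)⁻¹`. [cite: MochizukiFrdI2008, Def. 3.1 (iii) p.57] -/
theorem map_conj_inv_aux {𝒜 : Type*} [Category 𝒜] {E : Type*} [Category E] (M : 𝒜 ⥤ E)
    {a a₁ x b b₁ y : 𝒜} (fA : a ⟶ a₁) (jA : a₁ ≅ x) (ρ : a₁ ⟶ b₁) (fB : b ⟶ b₁) (jB : b₁ ≅ y)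
    {fA' : a ⟶ x} {fB' : b ⟶ y} (hA : fA ≫ jA.hom = fA') (hB : fB ≫ jB.hom = fB')
    [IsIso (M.map fB)] [IsIso (M.map fB')] :
    M.map fA' ≫ M.map (jA.inv ≫ ρ ≫ jB.hom) ≫ inv (M.map fB') =
      M.map fA ≫ M.map ρ ≫ inv (M.map fB) := by
  subst hA hB
  rw [← cancel_mono (M.map (fB ≫ jB.hom))]
  simp only [M.map_comp, Category.assoc, IsIso.inv_hom_id, Category.comp_id,
    IsIso.inv_hom_id_assoc, Iso.map_hom_inv_id_assoc]

/-- `Base` in `(C^birat)^pf` of `P[r]` is `Base` in `C^pf` of `[r]` (`= Base(frob_A) ≫ Base(r) ≫ Base(frob_B)⁻¹`):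
the isomorphisms `(A^{(a)})^birat ≅ (A^birat)^{(a)}` lie under `A^birat` and `C → C^birat` lies over `D`
(Prop. 4.4 (i)). [cite: MochizukiFrdI2008, Prop. 5.5 (ii) p.104] -/
theorem base_map_perfMap_map {X Y : Perfection hF} (f : X ⟶ Y) :
    (Perfection.ops hBi).base.map ((perfMap hF hsq hBi).map f) = (Perfection.ops hF).base.map f := by
  obtain ⟨r, rfl⟩ := Perfection.Hom.mk_surjective f
  rw [perfMap_map_mk]
  change Perfection.Rep.baseMap (Perfection.repMap (hF₁ := hF) (hF₂ := hBi)
      (isFrobeniusCompatible_toBirat hF hsq) r) = Perfection.Rep.baseMap r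
  unfold Perfection.Rep.baseMap
  rw [Perfection.repMap_hom]
  -- the comparison isomorphisms `(A^{(a)})^birat ≅ (A^birat)^{(a)}`, `(B^{(b)})^birat ≅ (B^birat)^{(b)}`
  set jA := Perfection.frobPowIso (hF₁ := hF) (hF₂ := hBi) (isFrobeniusCompatible_toBirat hF hsq)
    X.obj r.L.a with hjA'
  set jB := Perfection.frobPowIso (hF₁ := hF) (hF₂ := hBi) (isFrobeniusCompatible_toBirat hF hsq)
    Y.obj r.L.b with hjB'
  have hjA : (toBirat F hF hsq).map (frob hF X.obj r.L.a) ≫ jA.hom =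
      frob hBi ((toBirat F hF hsq).obj X.obj) r.L.a :=
    Perfection.map_frob_frobPowIso (hF₁ := hF) (hF₂ := hBi) _ X.obj r.L.a
  have hjB : (toBirat F hF hsq).map (frob hF Y.obj r.L.b) ≫ jB.hom =
      frob hBi ((toBirat F hF hsq).obj Y.obj) r.L.b :=
    Perfection.map_frob_frobPowIso (hF₁ := hF) (hF₂ := hBi) _ Y.obj r.L.b
  haveI : IsIso ((biratOps hF hsq).base.map (frob hBi ((toBirat F hF hsq).obj Y.obj) r.L.b)) :=
    isIso_base_frob hBi _ r.L.b
  haveI : IsIso ((biratOps hF hsq).base.map ((toBirat F hF hsq).map (frob hF Y.obj r.L.b))) := by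
    rw [biratOps_base_map_toBirat]
    exact isIso_base_frob hF Y.obj r.L.b
  haveI : IsIso (Base F (frob hF Y.obj r.L.b)) := isIso_base_frob hF Y.obj r.L.b
  -- `Base` for the structure functor of `C^birat` is `(biratOps).base.map`
  change (biratOps hF hsq).base.map (frob hBi _ r.L.a) ≫
      (biratOps hF hsq).base.map (jA.inv ≫ (toBirat F hF hsq).map r.hom ≫ jB.hom) ≫
      inv ((biratOps hF hsq).base.map (frob hBi _ r.L.b)) = _
  rw [map_conj_inv_aux (biratOps hF hsq).base ((toBirat F hF hsq).map (frob hF X.obj r.L.a)) jA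
    ((toBirat F hF hsq).map r.hom) ((toBirat F hF hsq).map (frob hF Y.obj r.L.b)) jB hjA hjB]
  have e3 : inv ((biratOps hF hsq).base.map ((toBirat F hF hsq).map (frob hF Y.obj r.L.b))) =
      baseInvFrob hF Y.obj r.L.b := by
    apply IsIso.inv_eq_of_hom_inv_id
    rw [biratOps_base_map_toBirat]
    exact base_frob_baseInvFrob hF Y.obj r.L.b
  rw [e3, biratOps_base_map_toBirat, biratOps_base_map_toBirat]
  rfl

/-- `P` lies over `D` on the nose: `P ⋙ Base = Base`. [cite: MochizukiFrdI2008, Prop. 5.5 (ii) p.104] -/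
theorem perfMap_comp_base :
    perfMap hF hsq hBi ⋙ (Perfection.ops hBi).base = (Perfection.ops hF).base :=
  CategoryTheory.Functor.hext (fun _ => rfl) fun _ _ f => heq_of_eq (base_map_perfMap_map f)

/-- **Compatibility with the functors to the base**: the comparison functor lies over `D` on the nose,
`comparison ⋙ Base_{(C^birat)^pf} = Base_{(C^pf)^birat}` (both are induced on `(C^pf)^birat` by
`Base_{C^pf}`, Prop. 4.4 (i) uniqueness). [cite: MochizukiFrdI2008, Prop. 5.5 (ii) p.104] -/
theorem comparison_comp_base :
    comparison hF hsq hPf hsq' hBi ⋙ (Perfection.ops hBi).base =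
      (biratOps hPf hsq').base := by
  apply Birat.lift_unique
  change (toBirat (Perfection.ops hF).toFunctor hPf hsq' ⋙ comparison hF hsq hPf hsq' hBi) ⋙
      (Perfection.ops hBi).base = _
  rw [toBirat_comp_comparison, perfMap_comp_base, toBirat_comp_biratOps_base]
  rfl

/-- The same compatibility as a natural isomorphism, in the form used by the sub-statement
`FrdI.Prop55Sub.Prop55ii_birat`. [cite: MochizukiFrdI2008, Prop. 5.5 (ii) p.104] -/
noncomputable def comparisonCompBaseIso :
    comparison hF hsq hPf hsq' hBi ⋙ (Perfection.ops hBi).base ≅ (biratOps hPf hsq').base :=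
  eqToIso comparison_comp_base

end PerfectionBirat

end PreFrobenioid

end Literature.AlgebraicGeometry.Frobenioids
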